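import Literature.NumberTheory.Automorphic.UnitaryDiagonalFormTorusClasses  -- ★ part I of this road: (B) sign condition, (D) exhaustion, §3 book-keeping
import Literature.NumberTheory.Automorphic.ArchTorusWeylAction              -- ★ F0P3a-p06 (p838375): `monomial_conj_circleDiagonal`, `exists_conj_circleDiagonal_eq_of_sign`, `det_monomial_one_ne_zero`; ★ D1′b `circleDiagonal`, ★ `archLocal`
import Literature.NumberTheory.Rogawski1990.StableConjugacyU3                -- ★ `IsStablyConj` (LETTER #4 §5's currency: `GL_N(ℂ)`-conjugacy)
import HarnessLib

/-!
# Conjugacy classes inside the stable class of a REGULAR point of the circle torus, II: criterion, exhaustion, LIST and COUNT `C(N, p_w)` in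
# `G_w = U(σ_w diag α)(ℂ) = archLocal L N (diagonal α) w` — «three classes» at `U(2,1)`, one at a definite place (Rogawski 1990 §3.7 p. 30, §8.2 Prop. 8.2.1 p. 118, §14.2 p. 232)

Topic `NumberTheory/Automorphic`; namespace `Literature.NumberTheory.Automorphic.UnitaryGroup`.  THEOREMS ONLY (no definition, no instance, no notation, no named fact, no `sorry`).
Cell `pub/hodgecm-mathlib`, ENGINE T1 (crux H413 = `stmt-HodgeConjecture-24833`); floor-1 preparation, count-neutral, under books rows #88 (ST-∞) ∕ #111 (S-d): road D2′ gap **(V8)-reg**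
(F0P3a-p02 (g8) `CENSUS-D2prime-HClimit` §4: the `∑ᶠ` over the stable class in ★ `stableOrbitalIntegralRel` ∕ `archStableOrbitalIntegral` must be a FINITE sum with a KNOWN index set near a
regular elliptic `γ`); author F0P3a-p02 (g9) on LEAD WORD T7-3 (F0P3a-plan (g8), 2026-09-01; names «=»).  Sequel of ★ `UnitaryDiagonalFormTorusClasses` (part I: the sign condition (B)
and the exhaustion (D) for `U(⋆, diag e)(ℂ)`), docking F0P3a-p06 (g9)'s ★ `ArchTorusWeylAction` (the `⇐` direction, CITED BY NAME: ★ `exists_conj_circleDiagonal_eq_of_sign`,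
★ `monomial_conj_circleDiagonal`) and ★ D1′b `circleDiagonal` ∕ ★ D2′a `ArchLocalRegularCentralizer` (regular = `z` injective = ★ `isRegularElt_archDiagTorus_iff`).

WHAT IS PROVED (§4 for ANY subgroup `U ≤ GL_N(ℂ)` that IS `U(⋆, diag e)(ℂ)` through a membership hypothesis `hU`; §5 docks `U = archLocal L N (diagonal α) w`, `e_i = re σ_w(α_i)`):
* **`isConj_circleDiagonal_iff_exists_perm`** (A+B): for `z` injective, `diag(z) ∼_{G_w} diag(z′)` iff `z′ = z ∘ ρ` with `ρ` PRESERVING THE SIGNS `sign re σ_w(α_{ρ i}) = sign re σ_w(α_i)`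
  — the `U(p,q)`-classes of torus points in one stable class are the cosets `S_N ∕ (S_p × S_q)` (print: `Ω_F(T,G) = S₃`, `Ω(T,G) = ℤ∕2` over `ℝ`, §3.7);
* **`isStablyConj_circleDiagonal_iff_exists_perm`** (C): `diag(z) ∼_st diag(z′)` (★ `IsStablyConj (starRingEnd ℂ) (σ_w diag α)`) iff `z′ = z ∘ ρ`;
* **`exists_perm_isConj_circleDiagonal_of_isStablyConj`** (D): every `δ ∈ G_w` stably conjugate to a regular torus point is `G_w`-conjugate to a torus point `diag(z ∘ ρ)`;
* **`conjClasses_stable_circleDiagonal_eq_range`** ∕ `finite_conjClasses_stable_circleDiagonal` (E, list): `{q ∣ diag(z) ∼_st q.out} = range (ρ ↦ ⟦diag(z ∘ ρ)⟧)`, finite;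
* **`ncard_conjClasses_stable_circleDiagonal`** (E, count): its `ncard` is `Nat.choose N p_w`, `p_w = #{i ∣ 0 < re σ_w(α_i)}` (classes ↔ `ρ(P)` ↔ `p_w`-subsets of the eigenvalues —
  `mk_circleDiagonal_eq_mk_iff_image_eq_image`); corollaries **`…_eq_three`** (`N = 3`, signature `(2,1)` or `(1,2)`: Rogawski's `γ, γ₁, γ₂`) and **`…_eq_one_of_pos ∕ _of_neg`**
  (definite `w`: ONE class — the count form of ★ `isConj_of_isStablyConj_archLocal_of_posDef`, which is not re-derived).
NOT HERE (next bricks, named on the bus): «(V8)-sing» — the same for NON-injective `z` (per-eigenblock Sylvester; «2 classes through the split-singular `γ₀ = diag(a,a,b)` of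
`U(2,1)`», §3.8 Prop. 3.8.1); the GLOBAL product count on `arch = Π_w G_w` via ★ `archPiEquivCM`.
JUNK AUDIT: `Injective z` necessary throughout (singular points have block centralisers ∕ conjugators); `α_i ≠ 0` and `(σ_w α_i).im = 0` (hermitian, non-degenerate at `w`;
`im_embedding_eq_zero_of_complexConj_eq` supplies the latter from `c α_i = α_i` for a CM field) necessary for (A+B)(D)(E); (C) needs neither.
HONEST LABEL: HC_CM is proved only modulo the printed citations until rung 0 closes; this file is linear algebra ∕ combinatorics (count-neutral floor-1 preparation) and pays nothing by itself.

## References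
* [Rogawski1990] J. D. Rogawski, *Automorphic Representations of Unitary Groups in Three Variables*, Ann. of Math. Stud. 123 (1990): §3.1 p. 19, §3.7 Prop. 3.7.1 pp. 29–30
  (`Ω_F(T,G) = S₃`; over `ℝ`, `Ω(T,G) = ℤ∕2`), §3.8 Prop. 3.8.1 p. 30, §4.1 (4.1.1) p. 39 (`Φ^st = Σ_{γ′}` over the classes within `𝒪_st(γ)`), §4.9 p. 54, §8.2 Prop. 8.2.1 p. 118 (`γ, γ₁, γ₂`),
  §14.2 p. 232 (compact places: stable conjugacy = conjugacy) — held e-text chunks p0032–p0033, p0043, p0117–p0119 read; chunk p0119: «`X = {γ, γ′, γ″, γ‴}` … if `E∕F = ℂ∕ℝ`, then `γ‴` does not occur» — THREE classes.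
* [BrockerTomDieck1985] Th. Bröcker, T. tom Dieck, *Representations of Compact Lie Groups*, GTM 98 (1985), Ch. IV (3.1)–(3.2).
* [HornJohnson2013] R. A. Horn, C. R. Johnson, *Matrix Analysis*, 2nd ed. (2013), §4.5 Thm. 4.5.8 (Sylvester's law of inertia).
-/

set_option autoImplicit false

noncomputable section

open Matrix Equiv NumberField NumberField.InfinitePlace
open scoped MatrixGroups ComplexConjugate

namespace Literature.NumberTheory.Automorphic

namespace UnitaryGroup

open Literature.LinearAlgebra.Matrix Literature.NumberTheory.Rogawski1990

/-! ## §4 THE CLASSES OF THE CIRCLE TORUS `diag(z)`, `z ∈ (S¹)^N`, IN ANY REALISATION `U` OF `U(⋆, diag e)(ℂ)`: criterion, stable criterion, exhaustion, LIST and COUNT -/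

section Circle

variable (N : ℕ) (U : Subgroup (GL (Fin N) ℂ)) (e : Fin N → ℝ)

/-- The torus point `diag(z)` of ★ `circleDiagonal` as an element of a subgroup `U` that IS `U(⋆, diag e)(ℂ)`. [cite: BrockerTomDieck1985, Ch. IV (3.1)] -/
theorem circleDiagonal_mem_of_iff {e : Fin N → ℝ}
    (hU : ∀ g : GL (Fin N) ℂ, g ∈ U ↔ g ∈ unitaryGroupOfForm (starRingEnd ℂ) (diagonal fun i => (e i : ℂ))) (z : Fin N → Circle) :
    circleDiagonal N z ∈ U :=
  (hU _).mpr (circleDiagonal_mem_unitaryGroupOfForm_diagonal N z _)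

/-- **THE CRITERION (A+B)**: in any subgroup `U ≤ GL_N(ℂ)` that IS `U(⋆, diag e)(ℂ)` (membership hypothesis `hU`; e.g. ★ `archLocal L N (diagonal α) w`, §5), two REGULAR
torus points `diag(z)`, `diag(z′)` (`z` injective) are conjugate IN `U` iff `z′ = z ∘ ρ` for a permutation `ρ` PRESERVING THE SIGN PATTERN of `e` — the
`U(p,q)`-classes in the `GL_N(ℂ)`-class of a regular torus point are the cosets `S_N ∕ (S_p × S_q)`.  `⇐` is F0P3a-p06's ★ `exists_conj_circleDiagonal_eq_of_sign`
(weighted monomial conjugator), `⇒` is §2 (B). [cite: Rogawski1990, §3.8 pp. 30–32; §8.2 Prop. 8.2.1 p. 118] [cite: BrockerTomDieck1985, Ch. IV (3.2)] -/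
theorem isConj_circleDiagonal_iff_exists_perm_of_iff
    (hU : ∀ g : GL (Fin N) ℂ, g ∈ U ↔ g ∈ unitaryGroupOfForm (starRingEnd ℂ) (diagonal fun i => (e i : ℂ)))
    (he : ∀ i, e i ≠ 0) {z z' : Fin N → Circle} (hz : Function.Injective z) :
    IsConj (⟨circleDiagonal N z, circleDiagonal_mem_of_iff N U hU z⟩ : U) ⟨circleDiagonal N z', circleDiagonal_mem_of_iff N U hU z'⟩ ↔
      ∃ ρ : Perm (Fin N), z' = z ∘ ρ ∧ ∀ i, 0 < e (ρ i) ↔ 0 < e i := by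
  rw [isConj_subgroup_iff_exists]
  constructor
  · rintro ⟨u, hu, h⟩
    rw [coe_circleDiagonal, coe_circleDiagonal] at h
    have hzc : Function.Injective fun i => (z i : ℂ) := fun i j hij => hz (Circle.ext hij)
    obtain ⟨τ, d, -, hz', -, hsign⟩ := exists_perm_of_mem_unitaryGroupOfForm_mul_diagonal hzc ((hU u).mp hu) h
    refine ⟨τ.symm, funext fun i => Circle.ext ?_, fun i => ?_⟩
    · have h2 := hz' (τ.symm i)
      simp only [Equiv.apply_symm_apply] at h2
      rw [Function.comp_apply]; exact h2
    · rw [← hsign (τ.symm i), Equiv.apply_symm_apply]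
  · rintro ⟨ρ, rfl, hsign⟩
    have hpos : ∀ j, 0 < e j / e (ρ.symm j) := fun j =>
      div_pos_of_pos_iff (he j) (he _) (by rw [← hsign (ρ.symm j), Equiv.apply_symm_apply])
    obtain ⟨g, hg⟩ := exists_conj_circleDiagonal_eq_of_sign N hpos z
    refine ⟨g, (hU _).mpr g.2, ?_⟩
    have h1 := congrArg (fun x : GL (Fin N) ℂ => (x : Matrix (Fin N) (Fin N) ℂ)) (mul_inv_eq_iff_eq_mul.mp hg)
    simpa only [Units.val_mul, Equiv.symm_symm, Function.comp_def] using h1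

/-- **(C) STABLE CONJUGACY OF TORUS POINTS = PERMUTATION OF THE COORDINATES**: `diag(z) ∼_{GL_N(ℂ)} diag(z′)` iff `z′ = z ∘ ρ` (`z` injective; `⇐`, valid for all `z`,
is F0P3a-p06's ★ `monomial_conj_circleDiagonal`; `⇒` is §1). [cite: Rogawski1990, §3.1 p. 19; §3.8 p. 30] [cite: BrockerTomDieck1985, Ch. IV (3.2)] -/
theorem isConj_circleDiagonal_val_iff_exists_perm {z z' : Fin N → Circle} (hz : Function.Injective z) :
    IsConj (circleDiagonal N z) (circleDiagonal N z') ↔ ∃ ρ : Perm (Fin N), z' = z ∘ ρ := by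
  rw [isConj_units_iff_exists]
  constructor
  · rintro ⟨g, h⟩
    rw [coe_circleDiagonal, coe_circleDiagonal] at h
    have hzc : Function.Injective fun i => (z i : ℂ) := fun i j hij => hz (Circle.ext hij)
    obtain ⟨τ, d, -, -, hz'⟩ := exists_eq_monomial_of_units_mul_diagonal hzc g h
    refine ⟨τ.symm, funext fun i => Circle.ext ?_⟩
    have h2 := hz' (τ.symm i)
    simp only [Equiv.apply_symm_apply] at h2
    rw [Function.comp_apply]; exact h2
  · rintro ⟨ρ, rfl⟩
    refine ⟨Matrix.GeneralLinearGroup.mkOfDetNeZero _ (det_monomial_one_ne_zero N ρ.symm), ?_⟩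
    have h1 := congrArg (fun x : GL (Fin N) ℂ => (x : Matrix (Fin N) (Fin N) ℂ))
      (mul_inv_eq_iff_eq_mul.mp (monomial_conj_circleDiagonal N ρ.symm z))
    simpa only [Units.val_mul, Equiv.symm_symm, Function.comp_def] using h1

/-- **(D) EXHAUSTION, circle-torus form**: every `y ∈ U` that is `GL_N(ℂ)`-conjugate to the regular torus point `diag(z)` is `U`-conjugate to SOME torus point
`diag(z ∘ ρ)`. [cite: Rogawski1990, §3.8 pp. 30–32; §8.2 Prop. 8.2.1 p. 118] -/
theorem exists_perm_isConj_circleDiagonal_of_isConj_val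
    (hU : ∀ g : GL (Fin N) ℂ, g ∈ U ↔ g ∈ unitaryGroupOfForm (starRingEnd ℂ) (diagonal fun i => (e i : ℂ)))
    (he : ∀ i, e i ≠ 0) {z : Fin N → Circle} (hz : Function.Injective z) (y : U)
    (h : IsConj (circleDiagonal N z) (y : GL (Fin N) ℂ)) :
    ∃ ρ : Perm (Fin N), IsConj (⟨circleDiagonal N (z ∘ ρ), circleDiagonal_mem_of_iff N U hU (z ∘ ρ)⟩ : U) y := by
  obtain ⟨g, hg⟩ := (isConj_units_iff_exists _ _).mp h
  rw [coe_circleDiagonal] at hg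
  obtain ⟨ρ, u, hu, huc⟩ := exists_perm_mem_unitaryGroupOfForm_mul_diagonal_of_units he (Subtype.val_injective.comp hz)
    (fun i => Circle.norm_coe (z i)) ((hU _).mp y.2) g hg
  exact ⟨ρ, (isConj_subgroup_iff_exists U _ _).mpr ⟨u, (hU u).mpr hu, by rw [coe_circleDiagonal]; exact huc⟩⟩

/-- **(E) THE CLASSES INSIDE THE STABLE CLASS, LISTED**: the `U`-conjugacy classes whose members are `GL_N(ℂ)`-conjugate to the regular torus point `diag(z)` are
exactly the classes of the torus points `diag(z ∘ ρ)`, `ρ ∈ S_N` — in particular FINITELY many, so the `∑ᶠ` over the stable class in ★ `stableOrbitalIntegralRel` ∕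
`archStableOrbitalIntegral` is a finite sum at a regular elliptic `γ`. [cite: Rogawski1990, §3.8 pp. 30–32; §4.1 (4.1.1) p. 39] -/
theorem setOf_isConj_circleDiagonal_out_eq_range
    (hU : ∀ g : GL (Fin N) ℂ, g ∈ U ↔ g ∈ unitaryGroupOfForm (starRingEnd ℂ) (diagonal fun i => (e i : ℂ)))
    (he : ∀ i, e i ≠ 0) {z : Fin N → Circle} (hz : Function.Injective z) :
    {q : ConjClasses U | IsConj (circleDiagonal N z) ((Quotient.out q : U) : GL (Fin N) ℂ)} =
      Set.range fun ρ : Perm (Fin N) => ConjClasses.mk (⟨circleDiagonal N (z ∘ ρ), circleDiagonal_mem_of_iff N U hU (z ∘ ρ)⟩ : U) := by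
  ext q
  rw [Set.mem_setOf_eq, Set.mem_range]
  constructor
  · intro hq
    obtain ⟨ρ, hρ⟩ := exists_perm_isConj_circleDiagonal_of_isConj_val N U e hU he hz _ hq
    exact ⟨ρ, (ConjClasses.mk_eq_mk_iff_isConj.mpr hρ).trans (Quotient.out_eq q)⟩
  · rintro ⟨ρ, rfl⟩
    set t : U := ⟨circleDiagonal N (z ∘ ρ), circleDiagonal_mem_of_iff N U hU (z ∘ ρ)⟩ with ht
    have h1 : IsConj t (Quotient.out (ConjClasses.mk t) : U) := ConjClasses.mk_eq_mk_iff_isConj.mp (Quotient.out_eq (ConjClasses.mk t)).symm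
    have h2 : IsConj (circleDiagonal N z) (t : GL (Fin N) ℂ) := (isConj_circleDiagonal_val_iff_exists_perm N hz).mpr ⟨ρ, rfl⟩
    exact h2.trans (U.subtype.map_isConj h1)

/-- The set of classes in the stable class of a regular torus point is FINITE. [cite: Rogawski1990, §4.1 (4.1.1) p. 39] -/
theorem finite_setOf_isConj_circleDiagonal_out
    (hU : ∀ g : GL (Fin N) ℂ, g ∈ U ↔ g ∈ unitaryGroupOfForm (starRingEnd ℂ) (diagonal fun i => (e i : ℂ)))
    (he : ∀ i, e i ≠ 0) {z : Fin N → Circle} (hz : Function.Injective z) :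
    {q : ConjClasses U | IsConj (circleDiagonal N z) ((Quotient.out q : U) : GL (Fin N) ℂ)}.Finite := by
  rw [setOf_isConj_circleDiagonal_out_eq_range N U e hU he hz]
  exact Set.finite_range _

/-- Two torus points `diag(z ∘ ρ)`, `diag(z ∘ ρ′)` of one regular stable class are `U`-conjugate iff `ρ(P) = ρ′(P)` for the set `P = {i ∣ e_i > 0}` of positive weights
(the class remembers WHICH eigenvalues sit on positive lines). [cite: Rogawski1990, §3.8 pp. 30–32] -/
theorem mk_circleDiagonal_eq_mk_iff_image_eq_image
    (hU : ∀ g : GL (Fin N) ℂ, g ∈ U ↔ g ∈ unitaryGroupOfForm (starRingEnd ℂ) (diagonal fun i => (e i : ℂ)))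
    (he : ∀ i, e i ≠ 0) {z : Fin N → Circle} (hz : Function.Injective z) (ρ ρ' : Perm (Fin N)) :
    ConjClasses.mk (⟨circleDiagonal N (z ∘ ρ), circleDiagonal_mem_of_iff N U hU (z ∘ ρ)⟩ : U) =
        ConjClasses.mk (⟨circleDiagonal N (z ∘ ρ'), circleDiagonal_mem_of_iff N U hU (z ∘ ρ')⟩ : U) ↔
      (Finset.univ.filter fun i => 0 < e i).image ρ = (Finset.univ.filter fun i => 0 < e i).image ρ' := by
  rw [ConjClasses.mk_eq_mk_iff_isConj, isConj_circleDiagonal_iff_exists_perm_of_iff N U e hU he (hz.comp ρ.injective)]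
  set P := Finset.univ.filter fun i => 0 < e i with hP
  have hmemP : ∀ i, i ∈ P ↔ 0 < e i := fun i => by rw [hP, Finset.mem_filter, and_iff_right (Finset.mem_univ _)]
  constructor
  · rintro ⟨κ, hκ, hsign⟩
    have hρ' : ρ' = ρ * κ := by
      ext i
      have h1 := congrFun hκ i
      simp only [Function.comp_apply] at h1
      rw [Perm.coe_mul, Function.comp_apply, hz h1]
    have hκP : P.image κ = P := (image_perm_eq_self_iff P κ).mpr fun i => by rw [hmemP, hmemP]; exact hsign i
    rw [hρ', Perm.coe_mul, ← Finset.image_image, hκP]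
  · intro himg
    refine ⟨ρ⁻¹ * ρ', funext fun i => ?_, fun i => ?_⟩
    · simp only [Function.comp_apply, Perm.coe_mul, Perm.coe_inv, Equiv.apply_symm_apply]
    · rw [← hmemP, ← hmemP, Perm.coe_mul, Function.comp_apply, Perm.coe_inv]
      constructor
      · intro hi
        have h1 : ρ' i ∈ P.image ρ := by rw [← Equiv.apply_symm_apply ρ (ρ' i)]; exact Finset.mem_image_of_mem ρ hi
        rw [himg] at h1
        obtain ⟨j, hj, hji⟩ := Finset.mem_image.mp h1
        rwa [← ρ'.injective hji]
      · intro hi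
        have h1 : ρ' i ∈ P.image ρ := by rw [himg]; exact Finset.mem_image_of_mem ρ' hi
        obtain ⟨j, hj, hji⟩ := Finset.mem_image.mp h1
        rw [← hji, Equiv.symm_apply_apply]; exact hj

/-- **(E) THE COUNT `#{classes in the stable class of a regular torus point} = C(N, p)`, `p = #{i ∣ e_i > 0}`** — `N!∕(p! q!)` for `U(p,q)`: THREE for `U(2,1)`, ONE for a
definite form (compact `U(N)`; consistent with ★ `isConj_of_isStablyConj_archLocal_of_posDef`).  Classes ↔ `ρ(P)` ↔ the `p`-subsets of the `N` eigenvalues (which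
eigenlines are positive).  This is the converse «exactly `|S_N ∕ (S_p × S_q)|`» to F0P3a-p06's ★ `exists_conj_circleDiagonal_eq_of_sign`. [cite: Rogawski1990, §3.8 pp. 30–32; §8.2 Prop. 8.2.1 p. 118; §14.2 p. 232]
[cite: HornJohnson2013, §4.5 Thm. 4.5.8] -/
theorem ncard_setOf_isConj_circleDiagonal_out_eq_choose
    (hU : ∀ g : GL (Fin N) ℂ, g ∈ U ↔ g ∈ unitaryGroupOfForm (starRingEnd ℂ) (diagonal fun i => (e i : ℂ)))
    (he : ∀ i, e i ≠ 0) {z : Fin N → Circle} (hz : Function.Injective z) :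
    {q : ConjClasses U | IsConj (circleDiagonal N z) ((Quotient.out q : U) : GL (Fin N) ℂ)}.ncard =
      Nat.choose N (Finset.univ.filter fun i => 0 < e i).card := by
  classical
  set F : Perm (Fin N) → ConjClasses U := fun ρ => ConjClasses.mk (⟨circleDiagonal N (z ∘ ρ), circleDiagonal_mem_of_iff N U hU (z ∘ ρ)⟩ : U)
    with hF
  have hrange : Set.range F = ↑(Finset.univ.image F) := by rw [Finset.coe_image, Finset.coe_univ, Set.image_univ]
  rw [setOf_isConj_circleDiagonal_out_eq_range N U e hU he hz, ← hF, hrange, Set.ncard_coe_finset,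
    card_image_eq_card_image_of_iff Finset.univ F (fun ρ => (Finset.univ.filter fun i => 0 < e i).image ρ)
      (fun a _ b _ => mk_circleDiagonal_eq_mk_iff_image_eq_image N U e hU he hz a b),
    image_univ_image_perm_eq_powersetCard, Finset.card_powersetCard, Finset.card_univ, Fintype.card_fin]

end Circle

/-! ## §5 DOCKING at a complex place `w`: `G_w = U(σ_w diag α)(ℂ) = archLocal L N (diagonal α) w`, hermitian non-degenerate diagonal `α` -/

section Place

variable (L : Type) [Field L] (N : ℕ) (α : Fin N → L) (w : {w : InfinitePlace L // IsComplex w})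

/-- For a CM field: a `c`-fixed entry `α_i` (`(diag α)` hermitian) has REAL image `σ_w(α_i)` at every complex place (Mathlib `IsCMField.complexEmbedding_complexConj`).
[cite: Rogawski1990, §4.9 p. 54] -/
theorem im_embedding_eq_zero_of_complexConj_eq [NumberField L] [IsCMField L] {a : L} (ha : (IsCMField.complexConj L a : L) = a) :
    (w.1.embedding a).im = 0 := by
  have h1 : starRingEnd ℂ (w.1.embedding a) = w.1.embedding a := by
    rw [← IsCMField.complexEmbedding_complexConj L w.1.embedding a, ha]
  exact Complex.conj_eq_iff_im.mp h1

/-- **`G_w = archLocal L N (diagonal α) w` IS `U(⋆, diag e)(ℂ)` with the REAL weights `e_i = re σ_w(α_i)`** (when `σ_w(α_i)` is real): the membership hypothesis `hU` of §4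
(★ `mem_archLocal_iff`, `Matrix.diagonal_map`, ★ `diagonal_eq_diagonal_ofReal_re`). [cite: Rogawski1990, §4.9 p. 54] [cite: BrockerTomDieck1985, Ch. IV (3.1)] -/
theorem mem_archLocal_diagonal_iff_mem_unitaryGroupOfForm (hreal : ∀ i, (w.1.embedding (α i)).im = 0) (g : GL (Fin N) ℂ) :
    g ∈ archLocal L N (diagonal α) w ↔
      g ∈ unitaryGroupOfForm (starRingEnd ℂ) (diagonal fun i => (((w.1.embedding (α i)).re : ℝ) : ℂ)) := by
  rw [mem_archLocal_iff, mem_unitaryGroupOfForm_iff, diagonal_map (map_zero _),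
    diagonal_eq_diagonal_ofReal_re (fun i => w.1.embedding (α i)) hreal]

omit w in
/-- Non-degeneracy at `w`: `α_i ≠ 0` with `σ_w(α_i)` real gives `re σ_w(α_i) ≠ 0`. [cite: Rogawski1990, §4.9 p. 54] -/
theorem re_embedding_ne_zero (w : {w : InfinitePlace L // IsComplex w}) (hα : ∀ i, α i ≠ 0)
    (hreal : ∀ i, (w.1.embedding (α i)).im = 0) (i : Fin N) : (w.1.embedding (α i)).re ≠ 0 := fun h0 =>
  (_root_.map_ne_zero w.1.embedding).mpr (hα i) (Complex.ext h0 (hreal i))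

/-- **`G_w`-CONJUGACY OF REGULAR TORUS POINTS ↔ SIGN-COMPATIBLE PERMUTATION** (§4 (A+B) docked): in `G_w = U(σ_w diag α)(ℂ)`, `diag(z) ∼ diag(z′)` (`z` injective, i.e. ★
`isRegularElt_archDiagTorus_iff` at `w`) iff `z′ = z ∘ ρ` with `sign re σ_w(α_{ρ i}) = sign re σ_w(α_i)` for all `i`.  At `U(2,1)` (signature `(2,1)` at `w`) the admissible `ρ` form
`S₂ × S₁`; at a definite `w` every `ρ` is admissible (consistent with ★ `isConj_of_isStablyConj_archLocal_of_posDef`). [cite: Rogawski1990, §3.8 pp. 30–32; §8.2 Prop. 8.2.1 p. 118; §14.2 p. 232]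
[cite: BrockerTomDieck1985, Ch. IV (3.2)] -/
theorem isConj_circleDiagonal_iff_exists_perm (hα : ∀ i, α i ≠ 0) (hreal : ∀ i, (w.1.embedding (α i)).im = 0)
    {z z' : Fin N → Circle} (hz : Function.Injective z) :
    IsConj (⟨circleDiagonal N z, circleDiagonal_mem_archLocal_diagonal L N α w z⟩ : archLocal L N (diagonal α) w)
        ⟨circleDiagonal N z', circleDiagonal_mem_archLocal_diagonal L N α w z'⟩ ↔
      ∃ ρ : Perm (Fin N), z' = z ∘ ρ ∧ ∀ i, 0 < (w.1.embedding (α (ρ i))).re ↔ 0 < (w.1.embedding (α i)).re :=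
  isConj_circleDiagonal_iff_exists_perm_of_iff N (archLocal L N (diagonal α) w) (fun i => (w.1.embedding (α i)).re)
    (mem_archLocal_diagonal_iff_mem_unitaryGroupOfForm L N α w hreal) (re_embedding_ne_zero L N α w hα hreal) hz

/-- **STABLE CONJUGACY OF REGULAR TORUS POINTS AT `w` ↔ PERMUTATION** (★ `IsStablyConj (starRingEnd ℂ) (σ_w (diag α))` = `GL_N(ℂ)`-conjugacy, LETTER #4 §5's currency):
`diag(z) ∼_st diag(z′)` iff `z′ = z ∘ ρ` — no form hypothesis. [cite: Rogawski1990, §3.1 p. 19; §3.8 p. 30] -/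
theorem isStablyConj_circleDiagonal_iff_exists_perm {z z' : Fin N → Circle} (hz : Function.Injective z) :
    IsStablyConj (starRingEnd ℂ) ((diagonal α).map w.1.embedding)
        (⟨circleDiagonal N z, circleDiagonal_mem_archLocal_diagonal L N α w z⟩ : archLocal L N (diagonal α) w)
        ⟨circleDiagonal N z', circleDiagonal_mem_archLocal_diagonal L N α w z'⟩ ↔
      ∃ ρ : Perm (Fin N), z' = z ∘ ρ :=
  isConj_circleDiagonal_val_iff_exists_perm N hz

/-- **EXHAUSTION AT `w`**: every `δ ∈ G_w` stably conjugate to the regular torus point `diag(z)` is `G_w`-conjugate to a torus point `diag(z ∘ ρ)` — the stable class of a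
regular point of the compact Cartan `T_w` is covered by the `S_N`-orbit in `T_w`. [cite: Rogawski1990, §3.8 pp. 30–32; §8.2 Prop. 8.2.1 p. 118] -/
theorem exists_perm_isConj_circleDiagonal_of_isStablyConj (hα : ∀ i, α i ≠ 0) (hreal : ∀ i, (w.1.embedding (α i)).im = 0)
    {z : Fin N → Circle} (hz : Function.Injective z) (δ : archLocal L N (diagonal α) w)
    (h : IsStablyConj (starRingEnd ℂ) ((diagonal α).map w.1.embedding)
      (⟨circleDiagonal N z, circleDiagonal_mem_archLocal_diagonal L N α w z⟩ : archLocal L N (diagonal α) w) δ) :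
    ∃ ρ : Perm (Fin N), IsConj (⟨circleDiagonal N (z ∘ ρ), circleDiagonal_mem_archLocal_diagonal L N α w (z ∘ ρ)⟩ : archLocal L N (diagonal α) w) δ :=
  exists_perm_isConj_circleDiagonal_of_isConj_val N (archLocal L N (diagonal α) w) (fun i => (w.1.embedding (α i)).re)
    (mem_archLocal_diagonal_iff_mem_unitaryGroupOfForm L N α w hreal) (re_embedding_ne_zero L N α w hα hreal) hz δ h

/-- **THE CLASSES IN THE STABLE CLASS OF A REGULAR TORUS POINT OF `G_w`, LISTED** — exactly the classes of `diag(z ∘ ρ)`, `ρ ∈ S_N` (the index set of the `∑ᶠ` in ★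
`stableOrbitalIntegralRel (IsStablyConj ⋆ (σ_w H′))` at `γ = diag(z)`). [cite: Rogawski1990, §3.8 pp. 30–32; §4.1 (4.1.1) p. 39] -/
theorem conjClasses_stable_circleDiagonal_eq_range (hα : ∀ i, α i ≠ 0) (hreal : ∀ i, (w.1.embedding (α i)).im = 0)
    {z : Fin N → Circle} (hz : Function.Injective z) :
    {q : ConjClasses (archLocal L N (diagonal α) w) | IsStablyConj (starRingEnd ℂ) ((diagonal α).map w.1.embedding)
        (⟨circleDiagonal N z, circleDiagonal_mem_archLocal_diagonal L N α w z⟩ : archLocal L N (diagonal α) w) (Quotient.out q)} =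
      Set.range fun ρ : Perm (Fin N) =>
        ConjClasses.mk (⟨circleDiagonal N (z ∘ ρ), circleDiagonal_mem_archLocal_diagonal L N α w (z ∘ ρ)⟩ : archLocal L N (diagonal α) w) :=
  setOf_isConj_circleDiagonal_out_eq_range N (archLocal L N (diagonal α) w) (fun i => (w.1.embedding (α i)).re)
    (mem_archLocal_diagonal_iff_mem_unitaryGroupOfForm L N α w hreal) (re_embedding_ne_zero L N α w hα hreal) hz

/-- The same set is FINITE (for the regular stable class this sharpens ★ `finite_setOf_isStablyConj_classOrbitalIntegral_ne_zero_arch`, which needs a compactly supported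
test function). [cite: Rogawski1990, §4.1 (4.1.1) p. 39] -/
theorem finite_conjClasses_stable_circleDiagonal (hα : ∀ i, α i ≠ 0) (hreal : ∀ i, (w.1.embedding (α i)).im = 0)
    {z : Fin N → Circle} (hz : Function.Injective z) :
    {q : ConjClasses (archLocal L N (diagonal α) w) | IsStablyConj (starRingEnd ℂ) ((diagonal α).map w.1.embedding)
        (⟨circleDiagonal N z, circleDiagonal_mem_archLocal_diagonal L N α w z⟩ : archLocal L N (diagonal α) w) (Quotient.out q)}.Finite := by
  rw [conjClasses_stable_circleDiagonal_eq_range L N α w hα hreal hz]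
  exact Set.finite_range _

/-- **THE COUNT AT `w`: `#{G_w-classes in the stable class of a regular torus point} = C(N, p_w)`**, `p_w = #{i ∣ re σ_w(α_i) > 0}` the number of positive weights of the
form at `w` (`N! ∕ (p_w! q_w!)`). [cite: Rogawski1990, §3.8 pp. 30–32; §8.2 Prop. 8.2.1 p. 118] [cite: HornJohnson2013, §4.5 Thm. 4.5.8] -/
theorem ncard_conjClasses_stable_circleDiagonal (hα : ∀ i, α i ≠ 0) (hreal : ∀ i, (w.1.embedding (α i)).im = 0)
    {z : Fin N → Circle} (hz : Function.Injective z) :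
    {q : ConjClasses (archLocal L N (diagonal α) w) | IsStablyConj (starRingEnd ℂ) ((diagonal α).map w.1.embedding)
        (⟨circleDiagonal N z, circleDiagonal_mem_archLocal_diagonal L N α w z⟩ : archLocal L N (diagonal α) w) (Quotient.out q)}.ncard =
      Nat.choose N (Finset.univ.filter fun i => 0 < (w.1.embedding (α i)).re).card :=
  ncard_setOf_isConj_circleDiagonal_out_eq_choose N (archLocal L N (diagonal α) w) (fun i => (w.1.embedding (α i)).re)
    (mem_archLocal_diagonal_iff_mem_unitaryGroupOfForm L N α w hreal) (re_embedding_ne_zero L N α w hα hreal) hz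

/-- **«THREE CLASSES» (Rogawski's `γ, γ₁, γ₂`)**: for `N = 3` at a place `w` of signature `(2,1)` — exactly two of `re σ_w(α_0), re σ_w(α_1), re σ_w(α_2)` positive — the stable
class of a regular point of the compact Cartan of `U(2,1)` consists of exactly `3` conjugacy classes. [cite: Rogawski1990, §8.2 Prop. 8.2.1 p. 118; §3.7 Prop. 3.7.1 pp. 29–30] -/
theorem ncard_conjClasses_stable_circleDiagonal_eq_three {α : Fin 3 → L} (hα : ∀ i, α i ≠ 0) (hreal : ∀ i, (w.1.embedding (α i)).im = 0)
    (hsig : (Finset.univ.filter fun i => 0 < (w.1.embedding (α i)).re).card = 2) {z : Fin 3 → Circle} (hz : Function.Injective z) :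
    {q : ConjClasses (archLocal L 3 (diagonal α) w) | IsStablyConj (starRingEnd ℂ) ((diagonal α).map w.1.embedding)
        (⟨circleDiagonal 3 z, circleDiagonal_mem_archLocal_diagonal L 3 α w z⟩ : archLocal L 3 (diagonal α) w) (Quotient.out q)}.ncard = 3 := by
  rw [ncard_conjClasses_stable_circleDiagonal L 3 α w hα hreal hz, hsig]
  rfl

/-- Signature `(1,2)` (the form `−Φ`): again `3` classes (`C(3,1) = 3`). [cite: Rogawski1990, §8.2 Prop. 8.2.1 p. 118] -/
theorem ncard_conjClasses_stable_circleDiagonal_eq_three' {α : Fin 3 → L} (hα : ∀ i, α i ≠ 0) (hreal : ∀ i, (w.1.embedding (α i)).im = 0)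
    (hsig : (Finset.univ.filter fun i => 0 < (w.1.embedding (α i)).re).card = 1) {z : Fin 3 → Circle} (hz : Function.Injective z) :
    {q : ConjClasses (archLocal L 3 (diagonal α) w) | IsStablyConj (starRingEnd ℂ) ((diagonal α).map w.1.embedding)
        (⟨circleDiagonal 3 z, circleDiagonal_mem_archLocal_diagonal L 3 α w z⟩ : archLocal L 3 (diagonal α) w) (Quotient.out q)}.ncard = 3 := by
  rw [ncard_conjClasses_stable_circleDiagonal L 3 α w hα hreal hz, hsig]
  rfl

/-- **ONE CLASS AT A DEFINITE PLACE**: if all the weights `re σ_w(α_i)` are positive (totally: `σ_w(diag α)` positive definite, the compact `U(N)`), the stable class of a regular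
torus point is a single conjugacy class (`C(N, N) = 1`) — the count form of ★ `isConj_of_isStablyConj_archLocal_of_posDef`. [cite: Rogawski1990, §14.2 p. 232] -/
theorem ncard_conjClasses_stable_circleDiagonal_eq_one_of_pos (hα : ∀ i, α i ≠ 0) (hreal : ∀ i, (w.1.embedding (α i)).im = 0)
    (hpos : ∀ i, 0 < (w.1.embedding (α i)).re) {z : Fin N → Circle} (hz : Function.Injective z) :
    {q : ConjClasses (archLocal L N (diagonal α) w) | IsStablyConj (starRingEnd ℂ) ((diagonal α).map w.1.embedding)
        (⟨circleDiagonal N z, circleDiagonal_mem_archLocal_diagonal L N α w z⟩ : archLocal L N (diagonal α) w) (Quotient.out q)}.ncard = 1 := by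
  rw [ncard_conjClasses_stable_circleDiagonal L N α w hα hreal hz]
  have h : (Finset.univ.filter fun i => 0 < (w.1.embedding (α i)).re) = Finset.univ := Finset.filter_true_of_mem fun i _ => hpos i
  rw [h, Finset.card_univ, Fintype.card_fin, Nat.choose_self]

/-- The negative definite place: all weights negative, again ONE class (`C(N, 0) = 1`). [cite: Rogawski1990, §14.2 p. 232] -/
theorem ncard_conjClasses_stable_circleDiagonal_eq_one_of_neg (hα : ∀ i, α i ≠ 0) (hreal : ∀ i, (w.1.embedding (α i)).im = 0)
    (hneg : ∀ i, (w.1.embedding (α i)).re < 0) {z : Fin N → Circle} (hz : Function.Injective z) :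
    {q : ConjClasses (archLocal L N (diagonal α) w) | IsStablyConj (starRingEnd ℂ) ((diagonal α).map w.1.embedding)
        (⟨circleDiagonal N z, circleDiagonal_mem_archLocal_diagonal L N α w z⟩ : archLocal L N (diagonal α) w) (Quotient.out q)}.ncard = 1 := by
  rw [ncard_conjClasses_stable_circleDiagonal L N α w hα hreal hz]
  have h : (Finset.univ.filter fun i => 0 < (w.1.embedding (α i)).re) = ∅ :=
    Finset.filter_false_of_mem fun i _ => not_lt.mpr (hneg i).le
  rw [h, Finset.card_empty, Nat.choose_zero_right]

end Place

end UnitaryGroup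

end Literature.NumberTheory.Automorphic

end
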